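import Summits.ABC.IUTFork.Joshi.TestScalingGenuineReal
import Summits.ABC.IUTFork.Cor312IdentifiedDHWitness
import HarnessLib

/-!
# Branch E TEST — the GENUINE-DATA twin of the object-honest Joshi model: the print-normalised real setting with the q-idele
# pinned at the LAST label (`log‖t_q‖` realising `ℓ*²·P_q = P_{Θ,ℓ*}`): J, `VolumeTransport` and the typed Cor. 3.12 HOLD, S FAILS

Record file of the abc-iut cell, branch E «type Joshi's construction, test vs S» (rung LADDER-ABC:A2.E; seat abc-iut-E-t4, gen 2;
ASSIGNMENTS §4 FALLBACK #1; sequel of `Joshi/TestFundamentalEstimateHonestModel.lean` p429514 — the interface-level object-honest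
Joshi-normalised model `honestJoshiSetting` (q-image `B_{ℓ*²}`, Θ-images `B_{j²}`) — and of `Joshi/TestScalingGenuineReal.lean`
p433340, where at abc-iut-c312-7's print-normalised real setting `Thm311.Real.settingPrVolSharp` with Θ- and q-ideles realising
Dupuy–Hilado's `P_Θ`, `P_q` Joshi's (9.9.4) reading J FAILS, the Θ-pilot following the `j²` law against `P_q`). **No side is taken**
on [IUTchIII] Cor. 3.12, on Joshi's claims (unrefereed arXiv preprints) or on Mochizuki's report on them; typed ≠ proved ≠ endorsed;
instantiated ≠ endorsed; establishment = our kernel check. PROOF-ONLY (0 definitions, no `Prop` fact, no `sorry`).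

## THE SETTING (nothing new is defined: c312-7's `settingPrVolSharp X hlog M archPk archSub Ψ act Mmod region n lat sig split qData tq t …`
with a DIFFERENT closed-form hypothesis on the q-idele)

Joshi normalises at the LAST label: the standard point `z_Θ = (y_1, …, y_{ℓ*})` has `y_{ℓ*} = y′_0` ([J-III] arXiv:2401.13508 §4.5
p.35 l.58–63) and (9.9.4) p.121 reads `|θ_j| = |q^{1/2ℓ}|^{j²/ℓ*²}` — the q-parameter of HIS inequality is the LAST theta value
(`j = ℓ*`: exponent `1`). In the genuine real vocabulary this is the q-idele hypothesis
  `htqJ : log ‖t_{q,v}‖ = −(ℓ*²·P_q(v))·ln|κ(v)|/n_v` (i.e. `t_q` realises `ℓ*²·P_q = P_{Θ,ℓ*}`, `PilotData.thetaPilot_eq_smul`)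
in place of c312-7's `htq : log ‖t_{q,v}‖ = −P_q(v)·ln|κ(v)|/n_v`; it is INHABITED by the last Θ-idele of any family `t` realising `P_Θ`
(`realisesJoshiQ_lastTheta`). The Θ-side (ideles `t` realising `P_Θ`, sharp boxes), the carriers, the container `summandPiecesPr`, the
frame, the context data are c312-7's VERBATIM — exactly as p429514 changed ONE glue field of the pinned countermodel.

## RESULTS (kernel; «as typed», at `settingPrVolSharp … tq t htq0 htq1` under `htqJ`)

* `qLocal_settingPrVolSharp_inr_of_realising` — c312-7's closed form `qLocal_settingPrVol_qCentreDH_inr` for an ARBITRARY realised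
  coefficient `c` (proof adapted verbatim from Cor312PilotIdelesPrNumbers.lean; the original is the case `c = −P_q`);
* **`thetaValuationScaling_joshiNormalised`**: J's `ThetaValuationScaling` HOLDS (`logvol(Θ_{m,(i+1),p}) = −(1/[F:ℚ])Σ(i+1)²P_q·log N =
  ((i+1)/ℓ*)²·qLocal`), `qLocalNonpos_joshiNormalised` (`P_q ≥ 0`: abc-iut's `ValLine.qPilot_nonneg`, `DHData.qPilot_pos_of_mem`), hence `volumeTransport_joshiNormalised` (Team B's input HOLDS here —
  contrast c312-7's `not_volumeTransport_settingPrVolSharp` under `htq`) and **`statement_joshiNormalised`: the typed Corollary 3.12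
  HOLDS at these genuine carriers, reached by Joshi's route** (`Joshi.statement_of_scaling`, bridge hypotheses and admissibility being
  c312-7's `bridgeHyps_settingPrVolSharp_of_ideles` / `thetaRegionsAdm_settingPrVolSharp`);
* the sequel `Joshi/TestGenuineJoshiNormalisedResidual.lean` adds: the two region pins + Thm. 3.11 (ii)(b) REFUTE S at these data
  (`not_pilotKummerIndRelated_joshiNormalised_of_pinned`, one packet: label `1`, the prime under a bad place) and the package
  `genuine_joshi_profile`. The hull-level residual S_H at these data is NOT addressed (director (E3): LANE A / C-cert).
READING (no side taken): the genuine-data picture matches the interface-level one (p429514/p429995/p433340): WHICH q-normalisation the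
pilot data carry decides J (true under `htqJ`, false under `htq`), the typed Cor. 3.12 inequality follows from J by volumes alone, and the
region-level residual S fails under the pins either way (p430714 under `htq`; here under `htqJ`). [claim: Joshi2024ATS3, status: disputed]
[claim: Mochizuki2012, status: disputed] [cite: DupuyHilado2025, §3.3–§3.4, §3.9, Thm. 3.10.1] [cite: ScholzeStix2018, §2.2 pp. 9–10].
-/

noncomputable section

open Set Function NumberField IsDedekindDomain
open scoped Pointwise

namespace Summit.ABC.IUTFork.Joshi

open Thm311 Thm311.Real Cor312 Cor312Vol Literature.IUT.LogThetaLattice Literature.IUT.LogVolume Literature.IUT.HodgeTheaters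

section GenuineJoshi

variable {F : Type} [Field F] [NumberField F] (X : PilotData F) {logv : PadicLogs F} (hlog : LogvAnalytic logv)
  (M : Type) [Field M] [NumberField M]
  (archPk : ∀ (j : (thetaIndex X).Label) (vQ : (thetaIndex X).VQ), Set ((logShellsDH X logv).Packet j vQ))
  (archSub : ∀ (j : (thetaIndex X).Label) (v : (thetaIndex X).V),
    Set ((logShellsDH X logv).Packet j ((thetaIndex X).over v)))
  (Ψ : ℤ → ∀ v : (thetaIndex X).V, v ∈ (thetaIndex X).Vbad → Set ((logShellsDH X logv).StarPacket v))
  (act : ℤ → ∀ v : (thetaIndex X).V, v ∈ (thetaIndex X).Vbad →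
    (logShellsDH X logv).StarPacket v → Module.End ℚ ((logShellsDH X logv).StarPacket v))
  (Mmod : ℤ → ∀ j : (thetaIndex X).LabelStar, Set ((logShellsDH X logv).GlobalPacket j.1))
  (region : ℤ → ∀ j : (thetaIndex X).LabelStar, FinDivisor M → ∀ vQ : (thetaIndex X).VQ,
    Set ((logShellsDH X logv).Packet j.1 vQ))
  (n : ℤ) {HT : Type} {LogLink : HT → HT → Type} {IsFull : ∀ {s t : HT}, LogLink s t → Prop}
  (lat : LGPGaussianLogThetaLattice LogLink IsFull)
  {Frd : Type} {IsoF : Frd → Frd → Type} {Ob : Frd → Type} {realify : Frd → Frd} {Strip : Type}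
  {IsoS : Strip → Strip → Type} {Mv : ∀ v : (thetaIndex X).V, v ∈ (thetaIndex X).Vbad → Type}
  [∀ v h, Monoid (Mv v h)]
  (sig : GlobalLGPFrobenioidSignature (thetaIndex X).lstar (thetaIndex X).V (· ∈ (thetaIndex X).Vbad)
    Frd IsoF Ob realify Strip IsoS Mv)
  (split : SplittingMonoids Mv) {ObΔ : Type} {N : ∀ v : (thetaIndex X).V, v ∈ (thetaIndex X).Vbad → Type}
  [∀ v h, Monoid (N v h)] (qData : QPilotData ObΔ N)
  (t : ∀ (pp : Nat.Primes) (_ : Fin X.lstar) (x : (thetaIndex X).Fibre (.inr pp)),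
    haveI : Fact (pp : ℕ).Prime := ⟨pp.2⟩; kOf X pp.1 x)
  (tq : ∀ (pp : Nat.Primes) (x : (thetaIndex X).Fibre (.inr pp)), haveI : Fact (pp : ℕ).Prime := ⟨pp.2⟩; kOf X pp.1 x)

/-! ## 1. The local q-volume for an ARBITRARY realised coefficient (c312-7's closed form, parametrised) -/

/-- **`−|log(q)|` locally at a prime for q-ideles realising the coefficient `c`**: if `log ‖t_{q,v}‖ = c(v)·ln|κ(v)|/n_v` then the
local q-volume of `settingPrVolSharp … tq t …` at `(j, p)` is `(1/[F:ℚ])·Σ_{v|p} c(v)·log N(v)`, for EVERY label `j`. Proof = c312-7's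
`qLocal_settingPrVol_qCentreDH_inr` (Cor312PilotIdelesPrNumbers.lean, the case `c = −P_q`) with the coefficient abstracted — adapted
verbatim, nothing restated. [cite: DupuyHilado2025, §3.9, Thm. 3.10.1] -/
theorem qLocal_settingPrVolSharp_inr_of_realising (htq0 : ∀ pp x, tq pp x ≠ 0)
    (htq1 : ∀ (pp : Nat.Primes) (x : (thetaIndex X).Fibre (.inr pp)),
      haveI : Fact (pp : ℕ).Prime := ⟨pp.2⟩; placeOf X pp.1 x ∉ X.S → ‖tq pp x‖ = 1)
    (c : HeightOneSpectrum (𝓞 F) → ℝ)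
    (htqc : ∀ (pp : Nat.Primes) (x : (thetaIndex X).Fibre (.inr pp)),
      haveI : Fact (pp : ℕ).Prime := ⟨pp.2⟩
      Real.log ‖tq pp x‖ = c (placeOf X pp.1 x) * logNorm F (placeOf X pp.1 x) / localDegree F (placeOf X pp.1 x))
    (j : (thetaIndex X).Label) (pp : Nat.Primes) :
    (settingPrVolSharp X hlog M archPk archSub Ψ act Mmod region n lat sig split qData tq t htq0 htq1).qLocal j (.inr pp) =
      (∑ v ∈ placesOver F pp, c v * logNorm F v) / Module.finrank ℚ F := by
  haveI : Fact (pp : ℕ).Prime := ⟨pp.2⟩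
  haveI : Nonempty ((thetaIndex X).Caps j) := ⟨0⟩
  have hg : ∀ (e : (thetaIndex X).Caps j → (thetaIndex X).Fibre (.inr pp)) (i : DIdx pp.1 ((presAtPr X hlog pp).kk e)),
      dEquiv pp.1 ((presAtPr X hlog pp).kk e)
        (iota pp.1 ((presAtPr X hlog pp).kk e) (Fin.last _) (tq pp (e (Fin.last _)))) i ≠ 0 :=
    fun e i => dEquiv_iota_ne_zero pp.1 _ (Fin.last _) (htq0 pp _) i
  have h := (presAtPr X hlog pp).factorMap_preimage_hullSet_centreOf
    (fun e => iota pp.1 ((presAtPr X hlog pp).kk e) (Fin.last _) (tq pp (e (Fin.last _)))) hg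
  have hadm : ∀ e : (thetaIndex X).Caps j → (thetaIndex X).Fibre (.inr pp),
      PacketAdm pp.1 ((presAtPr X hlog pp).kk e)
        (iota pp.1 ((presAtPr X hlog pp).kk e) (Fin.last _) (tq pp (e (Fin.last _))) •
          (normalizedPacket pp.1 ((presAtPr X hlog pp).kk e) : Set ((presAtPr X hlog pp).X e))) :=
    fun e => packetAdm_iota_smul pp.1 _ (Fin.last _) (htq0 pp _) (packetAdm_normalizedPacket pp.1 _)
  unfold settingPrVolSharp
  change (summandPiecesPr X hlog).logvol j (.inr pp)
    ((fun x => (presAtPr X hlog pp).factorMap j x) ⁻¹'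
      hullSet ((presAtPr X hlog pp).factorField j) ((presAtPr X hlog pp).centreOf fun e =>
        iota pp.1 ((presAtPr X hlog pp).kk e) (Fin.last _) (tq pp (e (Fin.last _))))) = _
  rw [h]
  refine logvol_preimage_pi_Pr_of_last X hlog pp j _ hadm c fun e => ?_
  rw [packetLogμ_iota_smul_normalizedPacket pp.1 _ (Fin.last _) (htq0 pp _)]
  exact htqc pp _

/-! ## 2. Joshi's q-normalisation is inhabited: the last Θ-idele realises `ℓ*²·P_q` -/

/-- `P_{Θ,ℓ*} = ℓ*²·P_q` placewise (`PilotData.thetaPilot_eq_smul` at the last index `i = ℓ* − 1`). [cite: DupuyHilado2025, §3.3] -/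
theorem thetaPilot_last_apply (v : HeightOneSpectrum (𝓞 F)) :
    X.thetaPilot ⟨X.lstar - 1, Nat.sub_lt (lt_of_lt_of_le two_pos X.two_le_lstar) one_pos⟩ v =
      ((X.lstar : ℝ) ^ 2) * X.qPilot v := by
  rw [PilotData.thetaPilot_eq_smul, Finsupp.smul_apply, smul_eq_mul]
  have h1 : 1 ≤ X.lstar := le_trans one_le_two X.two_le_lstar
  congr 2
  push_cast [Nat.cast_sub h1]
  ring

/-- **Joshi's q-normalisation is INHABITED at genuine data**: for any Θ-ideles `t` realising `P_Θ` (c312-7's `ht`), the LAST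
Θ-idele `v ↦ t_{Θ,ℓ*,v}` satisfies `htqJ` — it realises `ℓ*²·P_q` — and is a unit off `S` when `t` is. [cite: DupuyHilado2025, §3.3–§3.4] -/
theorem realisesJoshiQ_lastTheta
    (ht : ∀ (pp : Nat.Primes) (i : Fin X.lstar) (x : (thetaIndex X).Fibre (.inr pp)),
      haveI : Fact (pp : ℕ).Prime := ⟨pp.2⟩
      Real.log ‖t pp i x‖ = -(X.thetaPilot i (placeOf X pp.1 x)) * logNorm F (placeOf X pp.1 x) /
        localDegree F (placeOf X pp.1 x))
    (pp : Nat.Primes) (x : (thetaIndex X).Fibre (.inr pp)) :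
    haveI : Fact (pp : ℕ).Prime := ⟨pp.2⟩
    Real.log ‖t pp ⟨X.lstar - 1, Nat.sub_lt (lt_of_lt_of_le two_pos X.two_le_lstar) one_pos⟩ x‖ =
      -(((X.lstar : ℝ) ^ 2) * X.qPilot (placeOf X pp.1 x)) * logNorm F (placeOf X pp.1 x) /
        localDegree F (placeOf X pp.1 x) := by
  rw [ht, thetaPilot_last_apply]

/-! ## 3. Under Joshi's q-normalisation: J, volume transport and the typed Corollary 3.12 HOLD -/

/-- The print-normalised local q-quantity `A_p := (1/[F:ℚ])·Σ_{v|p} (−P_q(v))·log N(v)` is `≤ 0`. [cite: DupuyHilado2025, §3.3] -/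
theorem qSum_nonpos (pp : Nat.Primes) :
    (∑ v ∈ placesOver F pp, -(X.qPilot v) * logNorm F v) / Module.finrank ℚ F ≤ 0 :=
  div_nonpos_of_nonpos_of_nonneg
    (Finset.sum_nonpos fun v _ => mul_nonpos_of_nonpos_of_nonneg (neg_nonpos.2 (ValLine.qPilot_nonneg X v))
      (logNorm_pos F v).le)
    (Nat.cast_nonneg _)

/-- … and `< 0` at the prime under a bad place. [cite: DupuyHilado2025, §3.3] -/
theorem qSum_neg {v₀ : HeightOneSpectrum (𝓞 F)} (hv₀ : v₀ ∈ X.S) (pp : Nat.Primes)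
    (hp : haveI : Fact (pp : ℕ).Prime := ⟨pp.2⟩; v₀ ∈ placesOver F pp) :
    (∑ v ∈ placesOver F pp, -(X.qPilot v) * logNorm F v) / Module.finrank ℚ F < 0 := by
  classical
  haveI : Fact (pp : ℕ).Prime := ⟨pp.2⟩
  refine div_neg_of_neg_of_pos ?_ (by exact_mod_cast Module.finrank_pos)
  rw [← Finset.add_sum_erase _ _ hp]
  refine add_neg_of_neg_of_nonpos ?_ (Finset.sum_nonpos fun v _ =>
    mul_nonpos_of_nonpos_of_nonneg (neg_nonpos.2 (ValLine.qPilot_nonneg X v)) (logNorm_pos F v).le)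
  exact mul_neg_of_neg_of_pos (neg_neg_of_pos (DHData.qPilot_pos_of_mem X hv₀)) (logNorm_pos F v₀)

/-- **J HOLDS under Joshi's q-normalisation: `ThetaValuationScaling`** at the genuine carriers — at `(i+1, p)` every Kummer image has
log-volume `−(1/[F:ℚ])Σ_{v|p}(i+1)²P_q(v)·log N(v) = ((i+1)/ℓ*)²·qLocal` since `qLocal = −(1/[F:ℚ])Σ_{v|p} ℓ*²P_q(v)·log N(v)`; at `∞`
both sides vanish. [claim: Joshi2024ATS3, status: disputed] [cite: DupuyHilado2025, §3.3, Thm. 3.10.1] -/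
theorem thetaValuationScaling_joshiNormalised (ht0 : ∀ pp i x, t pp i x ≠ 0)
    (ht : ∀ (pp : Nat.Primes) (i : Fin X.lstar) (x : (thetaIndex X).Fibre (.inr pp)),
      haveI : Fact (pp : ℕ).Prime := ⟨pp.2⟩
      Real.log ‖t pp i x‖ = -(X.thetaPilot i (placeOf X pp.1 x)) * logNorm F (placeOf X pp.1 x) /
        localDegree F (placeOf X pp.1 x))
    (htq0 : ∀ pp x, tq pp x ≠ 0)
    (htq1 : ∀ (pp : Nat.Primes) (x : (thetaIndex X).Fibre (.inr pp)),
      haveI : Fact (pp : ℕ).Prime := ⟨pp.2⟩; placeOf X pp.1 x ∉ X.S → ‖tq pp x‖ = 1)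
    (htqJ : ∀ (pp : Nat.Primes) (x : (thetaIndex X).Fibre (.inr pp)),
      haveI : Fact (pp : ℕ).Prime := ⟨pp.2⟩
      Real.log ‖tq pp x‖ = -(((X.lstar : ℝ) ^ 2) * X.qPilot (placeOf X pp.1 x)) * logNorm F (placeOf X pp.1 x) /
        localDegree F (placeOf X pp.1 x)) :
    ThetaValuationScaling (settingPrVolSharp X hlog M archPk archSub Ψ act Mmod region n lat sig split qData tq t htq0 htq1) := by
  intro i vQ
  refine ⟨0, ?_⟩
  show ((situationPrVol X hlog M archPk archSub Ψ act Mmod region).D n).logvol (Setting.labelSucc i) vQ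
      ((settingPrVolSharp X hlog M archPk archSub Ψ act Mmod region n lat sig split qData tq t htq0 htq1).thetaRegion 0
        (Setting.labelSucc i) vQ) =
    scalingWeight (thetaIndex X) i *
      (settingPrVolSharp X hlog M archPk archSub Ψ act Mmod region n lat sig split qData tq t htq0 htq1).qLocal
        (Setting.labelSucc i) vQ
  cases vQ with
  | inl u =>
    unfold settingPrVolSharp
    rw [logvol_situationPrVol_inl,
      qLocal_settingPrVol_qCentreDH_inl X hlog M archPk archSub Ψ act Mmod region n lat sig split qData _ tq htq0 _,
      mul_zero]
  | inr pp =>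
    rw [qLocal_settingPrVolSharp_inr_of_realising X hlog M archPk archSub Ψ act Mmod region n lat sig split qData t tq htq0
      htq1 (fun v => -(((X.lstar : ℝ) ^ 2) * X.qPilot v)) htqJ]
    unfold settingPrVolSharp
    rw [logvol_thetaRegion_sharp_Pr_inr X hlog M archPk archSub Ψ act Mmod region n lat sig split qData t ht0 ht,
      mul_div_assoc', Finset.mul_sum]
    congr 1
    refine Finset.sum_congr rfl fun v _ => ?_
    rw [PilotData.thetaPilot_eq_smul, Finsupp.smul_apply, smul_eq_mul]
    have hl : ((thetaIndex X).lstar : ℝ) ≠ 0 := by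
      have := X.two_le_lstar
      exact_mod_cast (show (thetaIndex X).lstar ≠ 0 by change X.lstar ≠ 0; omega)
    unfold scalingWeight
    rw [show ((thetaIndex X).lstar : ℝ) = (X.lstar : ℝ) from rfl] at hl ⊢
    field_simp

/-- **`QLocalNonpos` under Joshi's q-normalisation** (`P_q ≥ 0`, `log N(v) > 0`). [folklore] -/
theorem qLocalNonpos_joshiNormalised (htq0 : ∀ pp x, tq pp x ≠ 0)
    (htq1 : ∀ (pp : Nat.Primes) (x : (thetaIndex X).Fibre (.inr pp)),
      haveI : Fact (pp : ℕ).Prime := ⟨pp.2⟩; placeOf X pp.1 x ∉ X.S → ‖tq pp x‖ = 1)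
    (htqJ : ∀ (pp : Nat.Primes) (x : (thetaIndex X).Fibre (.inr pp)),
      haveI : Fact (pp : ℕ).Prime := ⟨pp.2⟩
      Real.log ‖tq pp x‖ = -(((X.lstar : ℝ) ^ 2) * X.qPilot (placeOf X pp.1 x)) * logNorm F (placeOf X pp.1 x) /
        localDegree F (placeOf X pp.1 x)) :
    QLocalNonpos (settingPrVolSharp X hlog M archPk archSub Ψ act Mmod region n lat sig split qData tq t htq0 htq1) := by
  intro i vQ
  cases vQ with
  | inl u =>
    unfold settingPrVolSharp
    rw [qLocal_settingPrVol_qCentreDH_inl X hlog M archPk archSub Ψ act Mmod region n lat sig split qData _ tq htq0 _]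
  | inr pp =>
    rw [qLocal_settingPrVolSharp_inr_of_realising X hlog M archPk archSub Ψ act Mmod region n lat sig split qData t tq htq0
      htq1 (fun v => -(((X.lstar : ℝ) ^ 2) * X.qPilot v)) htqJ]
    refine div_nonpos_of_nonpos_of_nonneg (Finset.sum_nonpos fun v _ => ?_) (Nat.cast_nonneg _)
    exact mul_nonpos_of_nonpos_of_nonneg
      (neg_nonpos.2 (mul_nonneg (sq_nonneg _) (ValLine.qPilot_nonneg X v))) (logNorm_pos F v).le

/-- **Team B's `VolumeTransport` HOLDS under Joshi's q-normalisation** (from J, p428059's `volumeTransport_of_scaling`) — whereas under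
the print normalisation `htq` it FAILS (c312-7's `not_volumeTransport_settingPrVolSharp`). [claim: Joshi2024ATS3, status: disputed] -/
theorem volumeTransport_joshiNormalised (ht0 : ∀ pp i x, t pp i x ≠ 0)
    (ht : ∀ (pp : Nat.Primes) (i : Fin X.lstar) (x : (thetaIndex X).Fibre (.inr pp)),
      haveI : Fact (pp : ℕ).Prime := ⟨pp.2⟩
      Real.log ‖t pp i x‖ = -(X.thetaPilot i (placeOf X pp.1 x)) * logNorm F (placeOf X pp.1 x) /
        localDegree F (placeOf X pp.1 x))
    (htq0 : ∀ pp x, tq pp x ≠ 0)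
    (htq1 : ∀ (pp : Nat.Primes) (x : (thetaIndex X).Fibre (.inr pp)),
      haveI : Fact (pp : ℕ).Prime := ⟨pp.2⟩; placeOf X pp.1 x ∉ X.S → ‖tq pp x‖ = 1)
    (htqJ : ∀ (pp : Nat.Primes) (x : (thetaIndex X).Fibre (.inr pp)),
      haveI : Fact (pp : ℕ).Prime := ⟨pp.2⟩
      Real.log ‖tq pp x‖ = -(((X.lstar : ℝ) ^ 2) * X.qPilot (placeOf X pp.1 x)) * logNorm F (placeOf X pp.1 x) /
        localDegree F (placeOf X pp.1 x)) :
    VolumeTransport (settingPrVolSharp X hlog M archPk archSub Ψ act Mmod region n lat sig split qData tq t htq0 htq1) :=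
  volumeTransport_of_scaling
    (thetaValuationScaling_joshiNormalised X hlog M archPk archSub Ψ act Mmod region n lat sig split qData t tq ht0 ht htq0 htq1
      htqJ)
    (qLocalNonpos_joshiNormalised X hlog M archPk archSub Ψ act Mmod region n lat sig split qData t tq htq0 htq1 htqJ)

/-- **`statement_joshiNormalised` — THE TYPED COROLLARY 3.12 HOLDS at the genuine print-normalised real carriers under Joshi's
q-normalisation, reached by Joshi's route** (`Joshi.statement_of_scaling`: bridge hypotheses `bridgeHyps_settingPrVolSharp_of_ideles`,
admissible Kummer images `thetaRegionsAdm_settingPrVolSharp`, J and `QLocalNonpos` above). A statement about OUR typed objects at one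
instantiation; no side taken. [claim: Joshi2024ATS3, status: disputed] [claim: Mochizuki2012, status: disputed] -/
theorem statement_joshiNormalised (ht0 : ∀ pp i x, t pp i x ≠ 0)
    (ht : ∀ (pp : Nat.Primes) (i : Fin X.lstar) (x : (thetaIndex X).Fibre (.inr pp)),
      haveI : Fact (pp : ℕ).Prime := ⟨pp.2⟩
      Real.log ‖t pp i x‖ = -(X.thetaPilot i (placeOf X pp.1 x)) * logNorm F (placeOf X pp.1 x) /
        localDegree F (placeOf X pp.1 x))
    (ht1 : ∀ (pp : Nat.Primes) (i : Fin X.lstar) (x : (thetaIndex X).Fibre (.inr pp)),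
      haveI : Fact (pp : ℕ).Prime := ⟨pp.2⟩; placeOf X pp.1 x ∉ X.S → ‖t pp i x‖ = 1)
    (htq0 : ∀ pp x, tq pp x ≠ 0)
    (htq1 : ∀ (pp : Nat.Primes) (x : (thetaIndex X).Fibre (.inr pp)),
      haveI : Fact (pp : ℕ).Prime := ⟨pp.2⟩; placeOf X pp.1 x ∉ X.S → ‖tq pp x‖ = 1)
    (htqJ : ∀ (pp : Nat.Primes) (x : (thetaIndex X).Fibre (.inr pp)),
      haveI : Fact (pp : ℕ).Prime := ⟨pp.2⟩
      Real.log ‖tq pp x‖ = -(((X.lstar : ℝ) ^ 2) * X.qPilot (placeOf X pp.1 x)) * logNorm F (placeOf X pp.1 x) /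
        localDegree F (placeOf X pp.1 x)) :
    (settingPrVolSharp X hlog M archPk archSub Ψ act Mmod region n lat sig split qData tq t htq0 htq1).Statement :=
  statement_of_scaling _
    (bridgeHyps_settingPrVolSharp_of_ideles X hlog M archPk archSub Ψ act Mmod region n lat sig split qData t tq ht0 ht1 htq0 htq1)
    (thetaRegionsAdm_settingPrVolSharp X hlog M archPk archSub Ψ act Mmod region n lat sig split qData t tq ht0 htq0 htq1)
    (thetaValuationScaling_joshiNormalised X hlog M archPk archSub Ψ act Mmod region n lat sig split qData t tq ht0 ht htq0 htq1
      htqJ)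
    (qLocalNonpos_joshiNormalised X hlog M archPk archSub Ψ act Mmod region n lat sig split qData t tq htq0 htq1 htqJ)

end GenuineJoshi

end Summit.ABC.IUTFork.Joshi

end
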